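import Mathlib.Topology.Homeomorph.Lemmas
import Literature.AnabelianGeometry.AbsoluteAnabelian.AbsCuspFacts
import HarnessLib

/-!
# [AbsCusp] Thm. 1.1 (iii) / Thm. 2.1 (i) as typed: transport and functoriality of `Π ↦ Π^{c-ab}`

Proof-only companion of `AbsCuspFacts.lean`.  S. Mochizuki, *Absolute anabelian cuspidalizations
of proper hyperbolic curves*, J. Math. Kyoto Univ. 47 (2007) [cite: MochizukiAbsCusp2007,
Thm 2.1 (i) p.42]; locators = pages of the held copy (`paper:doi-10-1215-kjm-1250281022`).
Cell abc-iut, block F, FACT-LIST rows F-0051 `AbsCusp.Thm_1_1_iii` and F-0052 `AbsCusp.Thm_2_1_i`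
(trunk `AbsCuspFacts.lean`): parametrised PREDICATES on cuspidalization data whose universal
closures are REFUTED in kernel (`AbsCuspFactsSchemaRefutations.lean`); their instance forms at
geometric data are the printed theorems (named `_model` hypotheses, `CuspidalizationFactsModel`,
`AbsCuspSeparated`).  This file adds the STRUCTURAL side — what the typed predicates give for
free, i.e. the bracketed clauses of print recorded as `TODO(general form)` in their docstrings:
* TRANSPORT (`CuspidalizationData.exists_maxCuspAbelian_equiv_over`): an isomorphism of
  profinite groups `γ : Π_U ⥲ Π_V` over an isomorphism `α : Π ⥲ Π'` of the bases carries
  `I_U = Ker(Π_U ↠ Π)` onto `I_V` and `[I_U, I_U]⁻` onto `[I_V, I_V]⁻` (continuous maps of profinite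
  groups are closed), hence DESCENDS to `Π^{c-ab}_U ⥲ Π^{c-ab}_V` over `α` (Def. 1.1 (i) p. 10).  So
  `thm_2_1_i_of_lift`, `thm_1_1_iii_of_lift`: the typed conclusions hold whenever `α` (resp.
  `α × α`) LIFTS to the cuspidalization groups — the RELATIVE direction (e.g. `α` induced by an
  isomorphism of curves carrying `S` onto `T`).  HONEST LABEL: NOT the printed content, which
  produces `α^{c-ab}` from `α : Π_X ⥲ Π_Y` ALONE (reconstruction via Thm. 1.1 (iii) and Prop. 1.9,
  "specializing to `S`, `T`", proof p. 42); the typed predicate is implied by (and at the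
  `Π_U`-level weaker than) a lift.
* FUNCTORIALITY IN `α` (Thm. 2.1 (i) p. 42 "functorial with respect to `α`"; Thm. 1.1 (iii) p. 27):
  `Thm_2_1_i.symm`, `Thm_2_1_i.trans` (with `thm_2_1_i_refl` of the schema file, "related over
  some `α`" is an equivalence relation on cuspidalization data), `Thm_1_1_iii.symm`.
* OUTER INVARIANCE `Thm_2_1_i.conj` (composing `α` with an inner automorphism of `Π_Y` changes
  nothing) and INDETERMINACY `Thm_2_1_i.indeterminacy` ("[well-defined up to cuspidally inner
  automorphisms]": two `β` over the same `α` differ by an automorphism of `Π^{c-ab}_{V_T}` over the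
  identity of `Π_Y`; that these are CUSPIDALLY INNER is the printed rigidity Prop. 1.10 (i) p. 25,
  NOT derived here — the `∃`-typed predicate does not see the choice of `β`).
* CUSPIDAL PARTS (Thm. 1.1 (iii) "compatible with the natural inclusions"): ANY `β` over `α`
  carries `I^{c-ab}_{U_S} = Ker(Π^{c-ab}_{U_S} ↠ Π_X) = I/[I, I]⁻` onto `I^{c-ab}_{V_T}`
  (`ker_projAb_map_eq_of_over`, `CuspidalizationData.ker_projAb_eq_map_cuspidal`); hence the
  OBSTRUCTION `not_thm_2_1_i_of_ker_projAb` — the structural form of `not_forall_thm_2_1_i`.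
* NON-DEGENERATE CONSISTENCY INSTANCE of F-0051 exercising its inner `∀ (α, α_G)`:
  `thm_1_1_iii_of_injective_of_diagonal` (no cuspidal part, `D_X`, `D_Y` = the diagonals of
  `Π_X ×_G Π_X`: every compatible `(α, α_G)` admits `β`, induced by `α × α`).  The schema file had
  no consistency instance for F-0051.

Pure topological group theory over `FundamentalExtension` / `CuspidalizationData`; no definitions;
nothing is asserted about curves.  FACT-LIST vocabulary: F-0051 / F-0052 stay «universal closure
REFUTED; instance forms = named hypotheses»; this file supplies functoriality / transport clauses
and one consistency witness, not a discharge.  HONEST FRAMING: refereed results typed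
statements-first (D-0014); typed ≠ proved; implications between OUR typed predicates, not
statements about [AbsCusp]; nothing here bears on the disputed [IUTchIII] Cor. 3.12; no side taken.
-/

noncomputable section

open scoped Classical Pointwise

namespace Literature.AnabelianGeometry.AbsoluteAnabelian

namespace AbsCusp

universe u

/-! ### Closed continuous homomorphisms commute with topological closure of subgroups -/

/-- For a continuous CLOSED group homomorphism `f` (e.g. any continuous homomorphism from a
compact group to a Hausdorff group) and a subgroup `K`: `f(K⁻) = f(K)⁻`.  Used for the moduli
`[I, I]⁻`. [cite: MochizukiAbsCusp2007, Def 1.1 (i) p.10] -/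
theorem map_topologicalClosure_eq_of_isClosedMap {G H : Type*} [Group G] [TopologicalSpace G]
    [IsTopologicalGroup G] [Group H] [TopologicalSpace H] [IsTopologicalGroup H] (f : G →* H)
    (hf : Continuous f) (hf' : IsClosedMap f) (K : Subgroup G) :
    K.topologicalClosure.map f = (K.map f).topologicalClosure := by
  apply SetLike.coe_injective
  simp only [Subgroup.coe_map, Subgroup.topologicalClosure_coe]
  exact (hf'.closure_image_eq_of_continuous hf _).symm

namespace CuspidalizationData

variable {P Q : Type u} [Group P] [TopologicalSpace P] [Group Q] [TopologicalSpace Q]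

/-- An isomorphism `γ : Π_U ⥲ Π_V` of cuspidalization groups lying over an isomorphism
`α : Π ⥲ Π'` of the bases maps the cuspidal subgroup `I_U = Ker(Π_U ↠ Π)` ONTO `I_V`.
[cite: MochizukiAbsCusp2007, Def 1.1 (i) p.10] -/
theorem map_cuspidal_eq_of_over (D : CuspidalizationData P) (D' : CuspidalizationData Q)
    (γ : D.grp ≃* D'.grp) (α : P ≃* Q) (h : ∀ x, D'.proj (γ x) = α (D.proj x)) :
    D.cuspidal.map (γ : D.grp →* D'.grp) = D'.cuspidal := by
  ext y
  refine ⟨?_, fun (hy : D'.proj y = 1) => ⟨γ.symm y, ?_, γ.apply_symm_apply y⟩⟩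
  · rintro ⟨x, (hx : D.proj x = 1), rfl⟩
    change D'.proj (γ x) = 1
    rw [h, hx, map_one]
  · change D.proj (γ.symm y) = 1
    rw [← α.map_eq_one_iff, ← h, γ.apply_symm_apply, hy]

/-- … hence maps the modulus `[I_U, I_U]⁻` ONTO `[I_V, I_V]⁻`, provided `γ` is continuous (a
continuous map from the profinite `Π_U` to the Hausdorff `Π_V` is closed, so it commutes with
closures). [cite: MochizukiAbsCusp2007, Thm 1.1 (iii) p.27] -/
theorem map_cuspidallyAbelianModulus_eq_of_over (D : CuspidalizationData P)
    (D' : CuspidalizationData Q) (γ : D.grp ≃* D'.grp) (hγ : Continuous γ) (α : P ≃* Q)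
    (h : ∀ x, D'.proj (γ x) = α (D.proj x)) :
    D.cuspidallyAbelianModulus.map (γ : D.grp →* D'.grp) = D'.cuspidallyAbelianModulus := by
  have hclosed : IsClosedMap (γ : D.grp →* D'.grp) := Continuous.isClosedMap hγ
  change (⁅D.cuspidal, D.cuspidal⁆).topologicalClosure.map (γ : D.grp →* D'.grp) =
    (⁅D'.cuspidal, D'.cuspidal⁆).topologicalClosure
  rw [map_topologicalClosure_eq_of_isClosedMap (γ : D.grp →* D'.grp) hγ hclosed,
    Subgroup.map_commutator, map_cuspidal_eq_of_over D D' γ α h]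

/-- **Transport of the maximal cuspidally abelian quotient.**  An isomorphism of profinite groups
`γ : Π_U ⥲ Π_V` lying over an isomorphism `α : Π ⥲ Π'` of the bases DESCENDS to
`β : Π^{c-ab}_U ⥲ Π^{c-ab}_V` with `β [x] = [γ x]`, lying over `α` (Def. 1.1 (i): `Π ↦ Π^{c-ab}` is
functorial in isomorphisms over the base). [cite: MochizukiAbsCusp2007, Thm 1.1 (iii) p.27] -/
theorem exists_maxCuspAbelian_equiv_over [T1Space P] [T1Space Q] (D : CuspidalizationData P)
    (D' : CuspidalizationData Q) (γ : D.grp ≃* D'.grp) (hγ : Continuous γ) (α : P ≃* Q)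
    (h : ∀ x, D'.proj (γ x) = α (D.proj x)) :
    ∃ β : D.MaxCuspAbelian ≃* D'.MaxCuspAbelian,
      (∀ x : D.grp, β (QuotientGroup.mk x) = QuotientGroup.mk (γ x)) ∧
        ∀ z, D'.projAb (β z) = α (D.projAb z) := by
  refine ⟨QuotientGroup.congr D.cuspidallyAbelianModulus D'.cuspidallyAbelianModulus γ
      (map_cuspidallyAbelianModulus_eq_of_over D D' γ hγ α h), fun x => rfl, fun z => ?_⟩
  induction z using QuotientGroup.induction_on with
  | H x => exact h x

/-- The cuspidal subgroup of `Π^{c-ab}_U`, `I^{c-ab}_U := Ker(Π^{c-ab}_U ↠ Π)`, is the image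
`I_U/[I_U, I_U]⁻` of `I_U` ("the cuspidal subgroup of the maximal cuspidally abelian quotient",
proof of Prop. 1.9 p. 25). [cite: MochizukiAbsCusp2007, Prop 1.9 p.25] -/
theorem ker_projAb_eq_map_cuspidal [T1Space P] (D : CuspidalizationData P) :
    D.projAb.ker = D.cuspidal.map (QuotientGroup.mk' D.cuspidallyAbelianModulus) :=
  QuotientGroup.ker_lift _ _ _

end CuspidalizationData

/-! ### Thm. 2.1 (i): transport, functoriality in `α`, indeterminacy, cuspidal parts -/

section Thm21

variable {E F R : FundamentalExtension.{u}}

/-- **Thm. 2.1 (i) predicate ⇐ a lift of `α` to the cuspidalization groups** (the RELATIVE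
direction).  If `α : Π_X ⥲ Π_Y` lifts to an isomorphism of profinite groups
`γ : Π_{U_S} ⥲ Π_{V_T}` over it, the maximal cuspidally abelian quotients are identified over `α`.
NOT the printed content (there `α^{c-ab}` is produced from `α` alone).
[cite: MochizukiAbsCusp2007, Thm 2.1 (i) p.42] -/
theorem thm_2_1_i_of_lift (DS : CuspidalizationData E.arith) (DT : CuspidalizationData F.arith)
    (α : E.arith ≃ₜ* F.arith) (γ : DS.grp ≃* DT.grp) (hγ : Continuous γ)
    (h : ∀ x, DT.proj (γ x) = α (DS.proj x)) : Thm_2_1_i DS DT α := by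
  obtain ⟨β, -, hβ⟩ := DS.exists_maxCuspAbelian_equiv_over DT γ hγ α.toMulEquiv h
  exact ⟨β, hβ⟩

/-- **Functoriality in `α`, inverses**: an isomorphism `Π^{c-ab}_{U_S} ⥲ Π^{c-ab}_{V_T}` over `α`
gives one `Π^{c-ab}_{V_T} ⥲ Π^{c-ab}_{U_S}` over `α⁻¹`. [cite: MochizukiAbsCusp2007, Thm 2.1 (i) p.42] -/
theorem Thm_2_1_i.symm {DS : CuspidalizationData E.arith} {DT : CuspidalizationData F.arith}
    {α : E.arith ≃ₜ* F.arith} (hα : Thm_2_1_i DS DT α) : Thm_2_1_i DT DS α.symm := by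
  obtain ⟨β, hβ⟩ := hα
  refine ⟨β.symm, fun w => ?_⟩
  have hw := hβ (β.symm w)
  rw [β.apply_symm_apply] at hw
  exact (congrArg α.symm hw).trans (α.symm_apply_apply _) |>.symm

/-- **Functoriality in `α`, composites**: isomorphisms of the maximal cuspidally abelian
quotients over `α : Π_X ⥲ Π_Y` and `α' : Π_Y ⥲ Π_Z` compose to one over `α' ∘ α` (with
`thm_2_1_i_refl` and `Thm_2_1_i.symm`: "related over some `α`" is an equivalence relation on
cuspidalization data). [cite: MochizukiAbsCusp2007, Thm 2.1 (i) p.42] -/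
theorem Thm_2_1_i.trans {DS : CuspidalizationData E.arith} {DT : CuspidalizationData F.arith}
    {DR : CuspidalizationData R.arith} {α : E.arith ≃ₜ* F.arith} {α' : F.arith ≃ₜ* R.arith}
    (hα : Thm_2_1_i DS DT α) (hα' : Thm_2_1_i DT DR α') : Thm_2_1_i DS DR (α.trans α') := by
  obtain ⟨β, hβ⟩ := hα
  obtain ⟨β', hβ'⟩ := hα'
  refine ⟨β.trans β', fun z => ?_⟩
  change DR.projAb (β' (β z)) = α' (α (DS.projAb z))
  rw [hβ', hβ]

/-- **Outer invariance**: replacing `α` by `α' = Inn(g) ∘ α` (`g ∈ Π_Y`) does not change the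
predicate — conjugate `β` by the class of a lift of `g` to `Π_{V_T}` (`Π_{V_T} ↠ Π_Y` is
surjective); so the predicate depends on `α` only as an outer isomorphism (Def. 1.1 (ii)
p. 10–11). [cite: MochizukiAbsCusp2007, Thm 2.1 (i) p.42] -/
theorem Thm_2_1_i.conj {DS : CuspidalizationData E.arith} {DT : CuspidalizationData F.arith}
    {α : E.arith ≃ₜ* F.arith} (hα : Thm_2_1_i DS DT α) (g : F.arith) (α' : E.arith ≃ₜ* F.arith)
    (hα' : ∀ x, α' x = g * α x * g⁻¹) : Thm_2_1_i DS DT α' := by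
  obtain ⟨β, hβ⟩ := hα
  obtain ⟨g', hg'⟩ := DT.proj_surjective g
  refine ⟨β.trans (MulAut.conj (QuotientGroup.mk g' : DT.MaxCuspAbelian)), fun z => ?_⟩
  change DT.projAb ((QuotientGroup.mk g' : DT.MaxCuspAbelian) * β z *
      (QuotientGroup.mk g' : DT.MaxCuspAbelian)⁻¹) = α' (DS.projAb z)
  rw [map_mul, map_mul, map_inv, hβ, hα']
  change DT.proj g' * _ * (DT.proj g')⁻¹ = _
  rw [hg']

/-- **Indeterminacy of `β`** ("[well-defined up to cuspidally inner automorphisms]"): two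
isomorphisms `β`, `β'` over the SAME `α` differ by the automorphism `δ = β' ∘ β⁻¹` of
`Π^{c-ab}_{V_T}` over the IDENTITY of `Π_Y` (`β' = δ ∘ β`).  That such automorphisms [preserving
the cuspidal datum] are cuspidally inner is the printed rigidity (Prop. 1.10 (i) p. 25, stated for
`U_{X×X}`), NOT derived here. [cite: MochizukiAbsCusp2007, Thm 2.1 (i) p.42] -/
theorem Thm_2_1_i.indeterminacy {DS : CuspidalizationData E.arith}
    {DT : CuspidalizationData F.arith} (α : E.arith ≃ₜ* F.arith)
    (β β' : DS.MaxCuspAbelian ≃* DT.MaxCuspAbelian) (hβ : ∀ z, DT.projAb (β z) = α (DS.projAb z))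
    (hβ' : ∀ z, DT.projAb (β' z) = α (DS.projAb z)) :
    ∃ δ : DT.MaxCuspAbelian ≃* DT.MaxCuspAbelian,
      (∀ w, DT.projAb (δ w) = DT.projAb w) ∧ ∀ z, β' z = δ (β z) := by
  refine ⟨β.symm.trans β', fun w => ?_, fun z => ?_⟩
  · change DT.projAb (β' (β.symm w)) = DT.projAb w
    rw [hβ', ← hβ (β.symm w), β.apply_symm_apply]
  · change β' z = β' (β.symm (β z))
    rw [β.symm_apply_apply]

/-- **Compatibility with the cuspidal parts is automatic**: ANY isomorphism
`β : Π^{c-ab}_{U_S} ⥲ Π^{c-ab}_{V_T}` over `α` carries `I^{c-ab}_{U_S} = Ker(Π^{c-ab}_{U_S} ↠ Π_X)` onto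
`I^{c-ab}_{V_T}` (cf. Thm. 1.1 (iii) "compatible with the natural inclusions").
[cite: MochizukiAbsCusp2007, Thm 2.1 (i) p.42] -/
theorem ker_projAb_map_eq_of_over {DS : CuspidalizationData E.arith}
    {DT : CuspidalizationData F.arith} (α : E.arith ≃ₜ* F.arith)
    (β : DS.MaxCuspAbelian ≃* DT.MaxCuspAbelian) (hβ : ∀ z, DT.projAb (β z) = α (DS.projAb z)) :
    DS.projAb.ker.map (β : DS.MaxCuspAbelian →* DT.MaxCuspAbelian) = DT.projAb.ker := by
  ext w
  refine ⟨?_, fun (hw : DT.projAb w = 1) => ⟨β.symm w, ?_, β.apply_symm_apply w⟩⟩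
  · rintro ⟨z, (hz : DS.projAb z = 1), rfl⟩
    change DT.projAb (β z) = 1
    rw [hβ, hz, map_one]
  · change DS.projAb (β.symm w) = 1
    rw [← α.toMulEquiv.map_eq_one_iff]
    change α (DS.projAb (β.symm w)) = 1
    rw [← hβ, β.apply_symm_apply, hw]

/-- Under the Thm. 2.1 (i) predicate the abelianised cuspidal subgroups `I^{c-ab}_{U_S}`,
`I^{c-ab}_{V_T}` are isomorphic (restriction of `β`). [cite: MochizukiAbsCusp2007, Thm 2.1 (i) p.42] -/
theorem Thm_2_1_i.nonempty_ker_projAb_equiv {DS : CuspidalizationData E.arith}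
    {DT : CuspidalizationData F.arith} {α : E.arith ≃ₜ* F.arith} (hα : Thm_2_1_i DS DT α) :
    Nonempty (DS.projAb.ker ≃* DT.projAb.ker) := by
  obtain ⟨β, hβ⟩ := hα
  exact ⟨(β.subgroupMap DS.projAb.ker).trans
    (MulEquiv.subgroupCongr (ker_projAb_map_eq_of_over α β hβ))⟩

/-- Under the Thm. 2.1 (i) predicate, `I^{c-ab}_{U_S} = 1` iff `I^{c-ab}_{V_T} = 1`.
[cite: MochizukiAbsCusp2007, Thm 2.1 (i) p.42] -/
theorem Thm_2_1_i.ker_projAb_eq_bot_iff {DS : CuspidalizationData E.arith}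
    {DT : CuspidalizationData F.arith} {α : E.arith ≃ₜ* F.arith} (hα : Thm_2_1_i DS DT α) :
    DS.projAb.ker = ⊥ ↔ DT.projAb.ker = ⊥ := by
  obtain ⟨β, hβ⟩ := hα
  rw [← ker_projAb_map_eq_of_over α β hβ]
  refine ⟨fun h => by rw [h, Subgroup.map_bot], fun h => ?_⟩
  exact (Subgroup.map_eq_bot_iff_of_injective DS.projAb.ker
    (f := (β : DS.MaxCuspAbelian →* DT.MaxCuspAbelian)) β.injective).mp h

/-- **OBSTRUCTION** (structural form of the junk witness in `not_forall_thm_2_1_i`): if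
`Π^{c-ab}_{U_S} ↠ Π_X` is injective (no abelianised cuspidal part, e.g. `S = ∅`) while
`I^{c-ab}_{V_T} ≠ 1`, NO isomorphism of the maximal cuspidally abelian quotients lies over any
`α` — the cusps must correspond. [cite: MochizukiAbsCusp2007, Thm 2.1 (i) p.42] -/
theorem not_thm_2_1_i_of_ker_projAb {DS : CuspidalizationData E.arith}
    {DT : CuspidalizationData F.arith} (hS : DS.projAb.ker = ⊥) (hT : DT.projAb.ker ≠ ⊥)
    (α : E.arith ≃ₜ* F.arith) : ¬ Thm_2_1_i DS DT α :=
  fun hα => hT (hα.ker_projAb_eq_bot_iff.mp hS)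

end Thm21

/-! ### Thm. 1.1 (iii): transport, symmetry, and a non-degenerate consistency instance -/

section Thm11

variable {E F : FundamentalExtension.{u}}

/-- The compatibility `F.aug ∘ α = α_G ∘ E.aug` passes to the inverses.
[cite: MochizukiAbsCusp2007, Thm 1.1 (iii) p.27] -/
theorem aug_symm_comm (α : E.arith ≃ₜ* F.arith) (αG : E.gal ≃ₜ* F.gal)
    (hc : ∀ g, F.aug (α g) = αG (E.aug g)) (g : F.arith) :
    E.aug (α.symm g) = αG.symm (F.aug g) := by
  apply αG.injective
  rw [← hc, α.apply_symm_apply, αG.apply_symm_apply]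

/-- A pair `(α, α_G)` compatible with the augmentations induces a CONTINUOUS isomorphism
`α × α : Π_X ×_{G_{k_X}} Π_X ⥲ Π_Y ×_{G_{k_Y}} Π_Y` of the fibre products (`= Π_{X×X} ⥲ Π_{Y×Y}`,
§1 p. 6). [cite: MochizukiAbsCusp2007, Thm 1.1 (iii) p.27] -/
theorem exists_squareGroup_equiv (α : E.arith ≃ₜ* F.arith) (αG : E.gal ≃ₜ* F.gal)
    (hc : ∀ g, F.aug (α g) = αG (E.aug g)) :
    ∃ e : squareGroup E ≃* squareGroup F, Continuous e ∧
      ∀ p, ((e p : squareGroup F) : F.arith × F.arith) = squareMap α (p : E.arith × E.arith) := by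
  have hmem : ∀ p : squareGroup E, squareMap α (p : E.arith × E.arith) ∈ squareGroup F := by
    intro p
    change F.aug (α p.1.1) = F.aug (α p.1.2)
    rw [hc, hc, p.2]
  have hmem' : ∀ q : squareGroup F, squareMap α.symm (q : F.arith × F.arith) ∈ squareGroup E := by
    intro q
    change E.aug (α.symm q.1.1) = E.aug (α.symm q.1.2)
    rw [aug_symm_comm α αG hc, aug_symm_comm α αG hc, q.2]
  refine ⟨{ toFun := fun p => ⟨squareMap α (p : E.arith × E.arith), hmem p⟩
            invFun := fun q => ⟨squareMap α.symm (q : F.arith × F.arith), hmem' q⟩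
            left_inv := fun p =>
              Subtype.ext (Prod.ext (α.symm_apply_apply _) (α.symm_apply_apply _))
            right_inv := fun q =>
              Subtype.ext (Prod.ext (α.apply_symm_apply _) (α.apply_symm_apply _))
            map_mul' := fun p p' => Subtype.ext (Prod.ext (map_mul α _ _) (map_mul α _ _)) },
    ?_, fun p => rfl⟩
  apply Continuous.subtype_mk
  exact (α.continuous.comp (continuous_fst.comp continuous_subtype_val)).prodMk
    (α.continuous.comp (continuous_snd.comp continuous_subtype_val))

/-- **Thm. 1.1 (iii) predicate ⇐ lifts of `α × α` to the cuspidalization groups** (the RELATIVE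
direction).  If for every compatible pair `(α, α_G)` the map `α × α : Π_{X×X} ⥲ Π_{Y×Y}` lifts to
an isomorphism of profinite groups `γ : Π_{U_{X×X}} ⥲ Π_{U_{Y×Y}}` whose descent carries `D_X` onto
`D_Y`, the typed conclusion holds (`β` = the descent of `γ`).  NOT the printed content (there
`α^{c-ab}` is produced from `α` alone). [cite: MochizukiAbsCusp2007, Thm 1.1 (iii) p.27] -/
theorem thm_1_1_iii_of_lift (DX : CuspidalizationData (squareGroup E))
    (DY : CuspidalizationData (squareGroup F)) (diagX : Subgroup DX.MaxCuspAbelian)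
    (diagY : Subgroup DY.MaxCuspAbelian)
    (h : ∀ (α : E.arith ≃ₜ* F.arith) (αG : E.gal ≃ₜ* F.gal), (∀ g, F.aug (α g) = αG (E.aug g)) →
      ∃ γ : DX.grp ≃* DY.grp, Continuous γ ∧
        (∀ x, ((DY.proj (γ x) : squareGroup F) : F.arith × F.arith) =
            squareMap α ((DX.proj x : squareGroup E) : E.arith × E.arith)) ∧
        ∀ x, (QuotientGroup.mk x : DX.MaxCuspAbelian) ∈ diagX ↔
          (QuotientGroup.mk (γ x) : DY.MaxCuspAbelian) ∈ diagY) :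
    Thm_1_1_iii DX DY diagX diagY := by
  intro α αG hc
  obtain ⟨γ, hγ, hover, hdiag⟩ := h α αG hc
  obtain ⟨αsq, -, hαsq⟩ := exists_squareGroup_equiv α αG hc
  have hover' : ∀ x, DY.proj (γ x) = αsq (DX.proj x) := fun x =>
    Subtype.ext (by rw [hαsq]; exact hover x)
  obtain ⟨β, hβmk, hβ⟩ := DX.exists_maxCuspAbelian_equiv_over DY γ hγ αsq hover'
  refine ⟨β, fun z => by rw [← hαsq, hβ z], ?_⟩
  ext w
  refine ⟨?_, fun hw => ⟨β.symm w, ?_, β.apply_symm_apply w⟩⟩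
  · rintro ⟨z, hz, rfl⟩
    induction z using QuotientGroup.induction_on with
    | H x =>
      change β (QuotientGroup.mk x) ∈ diagY
      rw [hβmk]
      exact (hdiag x).mp hz
  · obtain ⟨y, rfl⟩ := QuotientGroup.mk_surjective w
    obtain ⟨x, rfl⟩ := γ.surjective y
    have hx : β.symm (QuotientGroup.mk (γ x)) = QuotientGroup.mk x := by
      rw [MulEquiv.symm_apply_eq, hβmk]
    rw [hx]
    exact (hdiag x).mpr hw

/-- **Functoriality in `α`, inverses** for Thm. 1.1 (iii): the predicate is symmetric in
`(X, D_X) ↔ (Y, D_Y)` (apply it to `(α⁻¹, α_G⁻¹)` and invert `β`).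
[cite: MochizukiAbsCusp2007, Thm 1.1 (iii) p.27] -/
theorem Thm_1_1_iii.symm {DX : CuspidalizationData (squareGroup E)}
    {DY : CuspidalizationData (squareGroup F)} {diagX : Subgroup DX.MaxCuspAbelian}
    {diagY : Subgroup DY.MaxCuspAbelian} (h : Thm_1_1_iii DX DY diagX diagY) :
    Thm_1_1_iii DY DX diagY diagX := by
  intro α' αG' hc'
  obtain ⟨β, hβ, hdiag⟩ := h α'.symm αG'.symm (aug_symm_comm α' αG' hc')
  refine ⟨β.symm, fun w => ?_, ?_⟩
  · have hw := hβ (β.symm w)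
    rw [β.apply_symm_apply] at hw
    refine Prod.ext ?_ ?_
    · exact (congrArg (fun p => α' (Prod.fst p)) hw).trans (α'.apply_symm_apply _) |>.symm
    · exact (congrArg (fun p => α' (Prod.snd p)) hw).trans (α'.apply_symm_apply _) |>.symm
  · rw [← hdiag, Subgroup.map_map]
    convert Subgroup.map_id diagX
    ext z
    exact β.symm_apply_apply z

/-- **F-0051, non-degenerate consistency instance (diagonal not removed).**  If both
cuspidalization maps `Π_{U_{X×X}} ↠ Π_{X×X}`, `Π_{U_{Y×Y}} ↠ Π_{Y×Y}` are injective (no cuspidal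
part) and `D_X`, `D_Y` are the DIAGONALS `{(g, g)} ⊆ Π_X ×_G Π_X` (the decomposition group of the
diagonal divisor when nothing is removed), the Thm. 1.1 (iii) predicate holds: for EVERY
compatible `(α, α_G)`, `α × α` lifts (the projections are continuous bijections of profinite
groups, i.e. isomorphisms) and preserves diagonals.  Consistency of the typing with its inner
universal quantifier exercised; not a model witness. [cite: MochizukiAbsCusp2007, Thm 1.1 (iii) p.27] -/
theorem thm_1_1_iii_of_injective_of_diagonal (DX : CuspidalizationData (squareGroup E))
    (DY : CuspidalizationData (squareGroup F)) (hX : Function.Injective DX.proj)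
    (hY : Function.Injective DY.proj) (diagX : Subgroup DX.MaxCuspAbelian)
    (diagY : Subgroup DY.MaxCuspAbelian)
    (hdX : ∀ z, z ∈ diagX ↔
      ((DX.projAb z : squareGroup E) : E.arith × E.arith).1 =
        ((DX.projAb z : squareGroup E) : E.arith × E.arith).2)
    (hdY : ∀ w, w ∈ diagY ↔
      ((DY.projAb w : squareGroup F) : F.arith × F.arith).1 =
        ((DY.projAb w : squareGroup F) : F.arith × F.arith).2) :
    Thm_1_1_iii DX DY diagX diagY := by
  apply thm_1_1_iii_of_lift
  intro α αG hc
  obtain ⟨αsq, hαsq, hαsqv⟩ := exists_squareGroup_equiv α αG hc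
  let e1 : DX.grp ≃* squareGroup E :=
    MulEquiv.ofBijective (DX.proj : DX.grp →* squareGroup E) ⟨hX, DX.proj_surjective⟩
  let e3 : DY.grp ≃* squareGroup F :=
    MulEquiv.ofBijective (DY.proj : DY.grp →* squareGroup F) ⟨hY, DY.proj_surjective⟩
  have he3 : Continuous e3.symm :=
    Continuous.continuous_symm_of_equiv_compact_to_t2 (f := e3.toEquiv) DY.proj.continuous
  have hproj : ∀ x, DY.proj (e3.symm (αsq (e1 x))) = αsq (e1 x) := fun x =>
    MulEquiv.ofBijective_apply_symm_apply _ _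
  refine ⟨e1.trans (αsq.trans e3.symm), he3.comp (hαsq.comp DX.proj.continuous), fun x => ?_, fun x => ?_⟩
  · change ((DY.proj (e3.symm (αsq (e1 x))) : squareGroup F) : F.arith × F.arith) = _
    rw [hproj, hαsqv]
    rfl
  · rw [hdX, hdY]
    change ((DX.proj x : squareGroup E) : E.arith × E.arith).1 =
        ((DX.proj x : squareGroup E) : E.arith × E.arith).2 ↔
      ((DY.proj (e3.symm (αsq (e1 x))) : squareGroup F) : F.arith × F.arith).1 =
        ((DY.proj (e3.symm (αsq (e1 x))) : squareGroup F) : F.arith × F.arith).2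
    rw [hproj, hαsqv]
    change _ ↔ α ((DX.proj x : squareGroup E) : E.arith × E.arith).1 =
      α ((DX.proj x : squareGroup E) : E.arith × E.arith).2
    exact α.injective.eq_iff.symm

end Thm11

end AbsCusp

end Literature.AnabelianGeometry.AbsoluteAnabelian

end
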